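import Mathlib
import HarnessLib
import Summits.NavierStokesRegularity.NavierStokesRegularity.Theorems.TaylorModelRungThreeCertificateArrayEq
import Summits.NavierStokesRegularity.NavierStokesRegularity.Theorems.TaylorModelRungThreeCertificateCloser

/-!
# Crux K1b-DR (stmt-NavierStokesRegularity-23954), line `taylor-model` — ARRAY-coded twins of the tail test, the entry (Farkas) checker
# and the coefficient check, with their equalities to the list-coded versions

Completes `…CertificateArray` / `…CertificateArrayEq` (dss_58 (A)(i)): `CertTablesA.checkPolyTails`, `CertTablesA.checkEntryStage` /
`checkEntry` (entry data `EntryAuxA`, `EntryAuxA.toLists`), `CertTablesA.checkCoef` over `QS2`, and the equalities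
`checkPolyTails_toLists`, `checkEntryStage_toLists`, `checkEntry_toLists`, `checkCoef_toLists` — so all SEVEN Booleans of the closer
(`certificate_of_QS2_checks`, p611202) can be evaluated array-coded (compiled replay) and transported to `T.toLists` by rewriting.
MODEL-lattice rung TL-M3; nothing here is a statement about the Navier–Stokes equations.
-/

-- the sub-problem namespace repeats the summit name by design (D-0017)
set_option linter.dupNamespace false

namespace Summit.NavierStokesRegularity.NavierStokesRegularity.Theorems.TaylorModelCert

open Literature.Analysis.FluidPDE.TaoCascade

namespace CertTablesA

section Defs

variable {K : Type} [Field K] [LinearOrder K]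

/-- TAIL TEST, array-coded (as `CertTables.checkPolyTails`). [folklore] -/
def checkPolyTails (T : CertTablesA K) : Bool :=
  allN (T.N₀ + 1) fun j =>
    allN (max (T.stage j).ctr.size (T.stage j).rad.size) fun l =>
      decide ((T.stage j).ell.size ≤ l → |vgetA (T.stage j).ctr l| ≤ vgetA (T.stage j).rad l)

/-- Entry `[j][c][l]` of array-coded entry data (junk `0`). [folklore] -/
def lam3A (L : Array (Array (Array K))) (j c l : ℕ) : K := ((L.getD j #[]).getD c #[]).getD l 0

/-- ENTRY CHECK at stage `j`, array-coded (as `CertTables.checkEntryStage`). [folklore] -/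
def checkEntryStage (T : CertTablesA K) (E : EntryAuxA K) (j : ℕ) : Bool :=
  let G := T.stage j
  let N := T.node j 0
  let nl := G.ell.size
  allN T.n (fun c => decide (0 ≤ T.wgt j c)) &&
  allN T.n (fun c =>
    allN T.n (fun c' => decide (sumN nl (fun l => lam3A E.lamCi j c l * vgetA (G.ell.getD l #[]) c') = mgetA N.Ci c c')) &&
    decide (|sumN nl (fun l => lam3A E.lamCi j c l * vgetA G.ctr l) - sumN T.n (fun c' => mgetA N.Ci c c' * vgetA N.x c')| +
      sumN nl (fun l => |lam3A E.lamCi j c l| * vgetA G.rad l) ≤ vgetA N.rP c)) &&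
  allN T.n (fun c =>
    allN T.n (fun c' => decide (sumN nl (fun l => lam3A E.lamId j c l * vgetA (G.ell.getD l #[]) c') =
      if c' = c then 1 else 0)) &&
    decide (|sumN nl (fun l => lam3A E.lamId j c l * vgetA G.ctr l) - vgetA N.x c| +
      sumN nl (fun l => |lam3A E.lamId j c l| * vgetA G.rad l) ≤ G.dm * T.wgt j c))

/-- ENTRY CHECK, array-coded. [folklore] -/
def checkEntry (T : CertTablesA K) (E : EntryAuxA K) : Bool := allN (T.N₀ + 1) fun j => T.checkEntryStage E j

end Defs

/-- COEFFICIENT CHECK over `ℚ(√2)`, array-coded (as `CertTables.checkCoef`). [folklore] -/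
def checkCoef (T : CertTablesA QS2) : Bool :=
  allN T.m fun kk => allN 4 fun a => allN 4 fun b => allN 4 fun i => allN 4 fun μi =>
    decide (T.coefAt ⟨a % 4, Nat.mod_lt _ (by omega)⟩ ⟨b % 4, Nat.mod_lt _ (by omega)⟩ ⟨i % 4, Nat.mod_lt _ (by omega)⟩
        μi ((kk : ℤ) - T.Kb) =
      vgetA T.α (((a % 4 * 4 + b % 4) * 4 + i % 4) * 4 + μi) *
        (⟨0, 1⟩ : QS2) ^ (5 * (((kk : ℤ) - T.Kb) - (CertTables.shifts.getD μi (0, 0, 0)).2.2)))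

/-! ### Equalities to the list-coded versions -/

section Eq

variable {K : Type} [Field K] [LinearOrder K] (T : CertTablesA K)

/-- The tail test agrees. [folklore] -/
theorem checkPolyTails_toLists : T.toLists.checkPolyTails = T.checkPolyTails := by
  obtain ⟨-, -, -, hN⟩ := T.toLists_globals
  unfold CertTables.checkPolyTails checkPolyTails
  simp only [hN, toLists_stage]
  congr 1; funext j
  obtain ⟨-, -, -, -, -, hell, hctr, hrad, -⟩ := stage_toLists_fields (T.stage j)
  simp only [hell, hctr, hrad, Array.length_toList, vget_toList]
  unfold toLL; rw [Array.length_toList, Array.size_map]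

omit [LinearOrder K] in
/-- Entry data look-up agrees. [folklore] -/
theorem lam3_toLists (E : EntryAuxA K) (j c l : ℕ) :
    lam3 E.toLists.lamCi j c l = lam3A E.lamCi j c l ∧ lam3 E.toLists.lamId j c l = lam3A E.lamId j c l := by
  unfold lam3 lam3A EntryAuxA.toLists
  constructor <;>
  · simp only
    rw [show ([] : List (List K)) = toLL (#[] : Array (Array K)) from toLL_empty.symm,
      show (fun X : Array (Array K) => (X.map Array.toList).toList) = toLL from rfl, getD_toList_map, getD_toLL, getD_toList']

/-- The entry check at a stage agrees. [folklore] -/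
theorem checkEntryStage_toLists (E : EntryAuxA K) (j : ℕ) :
    T.toLists.checkEntryStage E.toLists j = T.checkEntryStage E j := by
  obtain ⟨-, -, -, -, -, hell, hctr, hrad, hdm⟩ := stage_toLists_fields (T.stage j)
  obtain ⟨-, -, -, -, -, -, -, -, hx0, -, hrP0, -, hCi0, -⟩ := node_toLists_fields (T.node j 0)
  have hl : ∀ c l, lam3 E.toLists.lamCi j c l = lam3A E.lamCi j c l := fun c l => (lam3_toLists E j c l).1
  have hl' : ∀ c l, lam3 E.toLists.lamId j c l = lam3A E.lamId j c l := fun c l => (lam3_toLists E j c l).2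
  unfold CertTables.checkEntryStage checkEntryStage
  simp only [toLists_stage, toLists_node, toLists_n, toLists_wgt_fn, hell, hctr, hrad, hdm, hx0, hrP0, hCi0, vget_toList, getD_toLL,
    mget_toLL, hl, hl']
  unfold toLL; rw [Array.length_toList, Array.size_map]

/-- The entry check agrees. [folklore] -/
theorem checkEntry_toLists (E : EntryAuxA K) : T.toLists.checkEntry E.toLists = T.checkEntry E := by
  obtain ⟨-, -, -, hN⟩ := T.toLists_globals
  unfold CertTables.checkEntry checkEntry
  simp only [hN, checkEntryStage_toLists]

end Eq

/-- The coefficient check agrees. [folklore] -/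
theorem checkCoef_toLists (T : CertTablesA QS2) : T.toLists.checkCoef = T.checkCoef := by
  unfold CertTables.checkCoef checkCoef
  simp only [toLists_m, toLists_coefAt, show T.toLists.α = T.α.toList from rfl, show T.toLists.Kb = T.Kb from rfl, vget_toList]

end CertTablesA

/-! ### The closer from ARRAY Booleans -/

/-- **The statement of `stub_certificate` from the SEVEN array-coded Booleans** (compiled replay) — transported to the
format of record by the `_toLists` equalities and closed by `certificate_of_QS2_checks` (p611202). [folklore] -/
theorem CertTablesA.certificate_of_checks (T : CertTablesA QS2) (A : ReadoutAux QS2) (B : StageAux QS2) (B'' : StaticAux QS2)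
    (E : EntryAuxA QS2) (hcoef : T.checkCoef = true) (hS : T.toLists.checkStatic B'' = true)
    (hSN : T.toLists.checkStageNumerics A B = true) (hC : T.checkChain = true) (hTail : T.checkPolyTails = true)
    (hEn : T.checkEntry E = true) (hRO : T.toLists.checkReadouts A = true) : TaylorModel.TaylorModelChainCertificate :=
  T.toLists.certificate_of_QS2_checks A B B'' E.toLists (by rw [T.checkCoef_toLists]; exact hcoef) hS hSN
    (by rw [T.checkChain_toLists]; exact hC) (by rw [T.checkPolyTails_toLists]; exact hTail)
    (by rw [T.checkEntry_toLists]; exact hEn) hRO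

end Summit.NavierStokesRegularity.NavierStokesRegularity.Theorems.TaylorModelCert
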